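import Mathlib
import HarnessLib
import Summits.NavierStokesRegularity.NavierStokesRegularity.Theorems.PoloidalWindowRigidity.Negative.CellField

/-!
# Item `LrcModEntire` (stmt-NavierStokesRegularity-20428, route `PoloidalWindowDoor`; crux K2 `PoloidalWindowRigidity`,
# skeleton twist-split v3) — negative side: the TWISTED (TH) COLUMN, I: one-variable data and definitions

Negative-side support (refuter seat ns-regularity-refuter1, cell ns-regularity-ideate; D-0081 §C). The registered skeleton
`Cruxes/LrcModEntire/Lines/twist_split.lean` (v3) reduces the item to two research stubs on TWISTING windows (twist bracket
`{∂₂v₂, v₂}ₕ ≠ 0`): `stub_twistingTH` (the shear slope IS a function of time and height, `∂₂v_b = m(t, x₂) ∂_b v₂`) and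
`stub_twistingThick`. Every earlier (M)-free witness of this lane is either UNTWISTED (cellular, drifting, Stuart, shifted
profiles) or has CONSTANT slope (crossed suction layers). The twisted column `V = (−P₁(x₂) sin x₀, −Q₁(x₂) sin x₁,
P(x₂) cos x₀ + Q(x₂) cos x₁)` (`…Negative.TwistedColumnField`, `…Negative.TwistedColumn`) is simultaneously twisting,
of (TH) type with a slope depending on height alone and NOT constant, frozen, poloidal, divergence-free, real-analytic
and Type-I bounded. This file holds its one-variable data and all DEFINITIONS of the witness (field `twistField`,
derivative `twistDeriv`, vorticity pattern `twistVort`/`twistVortDeriv`, profile `twistProfile t x = (−t)^{-1/2} V(x)`,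
`twistDzVzDeriv`, window `twistWindow`): `W = 2 + cos h ∈ [1, 3]`, the phase `θ` with `θ' = W²`,
`P = cos θ / W`, `Q = sin θ / W` — a closed-form fundamental pair of the shear ODE `y'' = m y` with `P' = P₁`, `Q' = Q₁`,
`P₁' = m P`, `Q₁' = m Q` (`hasDerivAt_twistP₁`, `hasDerivAt_twistQ₁`) for the slope
`m = (W cos h + 2 sin² h)/W² − W⁴ = −1 + 6/W − 6/W² − W⁴ < 0` (`twistSlope_eq`, `twistSlope_neg`), Wronskian
`P₁ Q − Q₁ P = −1` (`twistWronskian`).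
WHAT THIS IS NOT: not a claim about Navier–Stokes regularity — one-variable calculus for a kinematic witness. [folklore]
-/

noncomputable section

-- the summit and its single sub-problem share the name (CONVENTIONS §1), as in every Theorems file
set_option linter.dupNamespace false

namespace Summit.NavierStokesRegularity.NavierStokesRegularity.Theorems.LrcModEntire.Negative

open Set Function Filter Topology
open Summit.NavierStokesRegularity.NavierStokesRegularity.Theorems.PoloidalWindowRigidity.Negative

local notation "E3" => EuclideanSpace ℝ (Fin 3)
local notation "π" i => (EuclideanSpace.proj (𝕜 := ℝ) (i : Fin 3) : EuclideanSpace ℝ (Fin 3) →L[ℝ] ℝ)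
local notation "𝐞" i => (EuclideanSpace.single (i : Fin 3) (1 : ℝ) : EuclideanSpace ℝ (Fin 3))

/-! ## One-variable data: `W`, `θ`, `P`, `Q`, `P₁`, `Q₁` and the slope `m` -/

/-- `W(h) = 2 + cos h ∈ [1, 3]`. [folklore] -/
def twistW (h : ℝ) : ℝ := 2 + Real.cos h

/-- The phase `θ(h) = 9h/2 + 4 sin h + ½ sin h cos h`, the primitive of `W²` vanishing at `0`. [folklore] -/
def twistTheta (h : ℝ) : ℝ := 9 / 2 * h + 4 * Real.sin h + 1 / 2 * (Real.sin h * Real.cos h)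

/-- `P = cos θ / W`. [folklore] -/
def twistP (h : ℝ) : ℝ := Real.cos (twistTheta h) / twistW h

/-- `Q = sin θ / W`. [folklore] -/
def twistQ (h : ℝ) : ℝ := Real.sin (twistTheta h) / twistW h

/-- `P₁ = P' = −W sin θ + cos θ sin h / W²`. [folklore] -/
def twistP₁ (h : ℝ) : ℝ :=
  -(twistW h * Real.sin (twistTheta h)) + Real.cos (twistTheta h) * Real.sin h / twistW h ^ 2

/-- `Q₁ = Q' = W cos θ + sin θ sin h / W²`. [folklore] -/
def twistQ₁ (h : ℝ) : ℝ :=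
  twistW h * Real.cos (twistTheta h) + Real.sin (twistTheta h) * Real.sin h / twistW h ^ 2

/-- The shear slope `m(h) = (W cos h + 2 sin² h)/W² − W⁴` (`P₁' = m P`, `Q₁' = m Q`). [folklore] -/
def twistSlope (h : ℝ) : ℝ := (twistW h * Real.cos h + 2 * Real.sin h ^ 2) / twistW h ^ 2 - twistW h ^ 4

/-- The derivative of the slope, in closed form. [folklore] -/
def twistSlopeD (h : ℝ) : ℝ :=
  Real.sin h * ((3 * Real.cos h - twistW h) / twistW h ^ 2 +
    2 * (twistW h * Real.cos h + 2 * Real.sin h ^ 2) / twistW h ^ 3 + 4 * twistW h ^ 3)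

/-- `1 ≤ W`. [folklore] -/
theorem one_le_twistW (h : ℝ) : 1 ≤ twistW h := by
  unfold twistW; linarith [Real.neg_one_le_cos h]

/-- `W ≤ 3`. [folklore] -/
theorem twistW_le_three (h : ℝ) : twistW h ≤ 3 := by
  unfold twistW; linarith [Real.cos_le_one h]

/-- `0 < W`. [folklore] -/
theorem twistW_pos (h : ℝ) : 0 < twistW h := lt_of_lt_of_le one_pos (one_le_twistW h)

/-- `W ≠ 0`. [folklore] -/
theorem twistW_ne_zero (h : ℝ) : twistW h ≠ 0 := (twistW_pos h).ne'

/-- `W' = −sin h`. [folklore] -/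
theorem hasDerivAt_twistW (h : ℝ) : HasDerivAt twistW (-Real.sin h) h := by
  have H : HasDerivAt twistW _ h := (Real.hasDerivAt_cos h).const_add 2
  exact H

/-- `θ' = W²` (`9/2 + 4 cos h + (cos² h − sin² h)/2 = (2 + cos h)²`). [folklore] -/
theorem hasDerivAt_twistTheta (h : ℝ) : HasDerivAt twistTheta (twistW h ^ 2) h := by
  have H : HasDerivAt twistTheta _ h :=
    (((hasDerivAt_id h).const_mul (9 / 2 : ℝ)).add ((Real.hasDerivAt_sin h).const_mul 4)).add
      (((Real.hasDerivAt_sin h).mul (Real.hasDerivAt_cos h)).const_mul (1 / 2 : ℝ))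
  refine H.congr_deriv ?_
  unfold twistW
  linear_combination (-1 / 2 : ℝ) * Real.sin_sq_add_cos_sq h

/-- `(sin θ)' = cos θ · W²`. [folklore] -/
theorem hasDerivAt_sin_twistTheta (h : ℝ) :
    HasDerivAt (fun y => Real.sin (twistTheta y)) (Real.cos (twistTheta h) * twistW h ^ 2) h :=
  (Real.hasDerivAt_sin (twistTheta h)).comp h (hasDerivAt_twistTheta h)

/-- `(cos θ)' = −sin θ · W²`. [folklore] -/
theorem hasDerivAt_cos_twistTheta (h : ℝ) :
    HasDerivAt (fun y => Real.cos (twistTheta y)) (-Real.sin (twistTheta h) * twistW h ^ 2) h :=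
  (Real.hasDerivAt_cos (twistTheta h)).comp h (hasDerivAt_twistTheta h)

/-- `(W²)' = 2 W · (−sin h)`. [folklore] -/
theorem hasDerivAt_twistW_sq (h : ℝ) : HasDerivAt (fun y => twistW y ^ 2) (2 * twistW h * -Real.sin h) h := by
  have e : (fun y => twistW y ^ 2) = fun y => twistW y * twistW y := funext fun y => sq (twistW y)
  rw [e]
  have H : HasDerivAt (fun y => twistW y * twistW y) (-Real.sin h * twistW h + twistW h * -Real.sin h) h :=
    (hasDerivAt_twistW h).mul (hasDerivAt_twistW h)
  refine H.congr_deriv ?_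
  ring

/-- `(W⁴)' = 4 W³ · (−sin h)`. [folklore] -/
theorem hasDerivAt_twistW_pow_four (h : ℝ) :
    HasDerivAt (fun y => twistW y ^ 4) (4 * twistW h ^ 3 * -Real.sin h) h := by
  have e : (fun y => twistW y ^ 4) = fun y => twistW y ^ 2 * twistW y ^ 2 := funext fun y => by ring
  rw [e]
  have H : HasDerivAt (fun y => twistW y ^ 2 * twistW y ^ 2)
      (2 * twistW h * -Real.sin h * twistW h ^ 2 + twistW h ^ 2 * (2 * twistW h * -Real.sin h)) h :=
    (hasDerivAt_twistW_sq h).mul (hasDerivAt_twistW_sq h)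
  refine H.congr_deriv ?_
  ring

/-- `(sin² h)' = 2 sin h cos h`. [folklore] -/
theorem hasDerivAt_sin_sq (h : ℝ) : HasDerivAt (fun y => Real.sin y ^ 2) (2 * Real.sin h * Real.cos h) h := by
  have e : (fun y => Real.sin y ^ 2) = fun y => Real.sin y * Real.sin y := funext fun y => sq (Real.sin y)
  rw [e]
  have H : HasDerivAt (fun y => Real.sin y * Real.sin y) (Real.cos h * Real.sin h + Real.sin h * Real.cos h) h :=
    (Real.hasDerivAt_sin h).mul (Real.hasDerivAt_sin h)
  refine H.congr_deriv ?_
  ring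

/-- `P' = P₁`. [folklore] -/
theorem hasDerivAt_twistP (h : ℝ) : HasDerivAt twistP (twistP₁ h) h := by
  have hW := twistW_ne_zero h
  have H : HasDerivAt twistP
      ((-Real.sin (twistTheta h) * twistW h ^ 2 * twistW h - Real.cos (twistTheta h) * -Real.sin h) /
        twistW h ^ 2) h :=
    (hasDerivAt_cos_twistTheta h).div (hasDerivAt_twistW h) hW
  refine H.congr_deriv ?_
  unfold twistP₁
  field_simp
  ring

/-- `Q' = Q₁`. [folklore] -/
theorem hasDerivAt_twistQ (h : ℝ) : HasDerivAt twistQ (twistQ₁ h) h := by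
  have hW := twistW_ne_zero h
  have H : HasDerivAt twistQ
      ((Real.cos (twistTheta h) * twistW h ^ 2 * twistW h - Real.sin (twistTheta h) * -Real.sin h) /
        twistW h ^ 2) h :=
    (hasDerivAt_sin_twistTheta h).div (hasDerivAt_twistW h) hW
  refine H.congr_deriv ?_
  unfold twistQ₁
  field_simp
  ring

/-- `P₁' = m P`. [folklore] -/
theorem hasDerivAt_twistP₁ (h : ℝ) : HasDerivAt twistP₁ (twistSlope h * twistP h) h := by
  have hW := twistW_ne_zero h
  have hA : HasDerivAt (fun y => twistW y * Real.sin (twistTheta y))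
      (-Real.sin h * Real.sin (twistTheta h) + twistW h * (Real.cos (twistTheta h) * twistW h ^ 2)) h :=
    (hasDerivAt_twistW h).mul (hasDerivAt_sin_twistTheta h)
  have hB : HasDerivAt (fun y => Real.cos (twistTheta y) * Real.sin y)
      (-Real.sin (twistTheta h) * twistW h ^ 2 * Real.sin h + Real.cos (twistTheta h) * Real.cos h) h :=
    (hasDerivAt_cos_twistTheta h).mul (Real.hasDerivAt_sin h)
  have H : HasDerivAt twistP₁
      (-(-Real.sin h * Real.sin (twistTheta h) + twistW h * (Real.cos (twistTheta h) * twistW h ^ 2)) +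
        ((-Real.sin (twistTheta h) * twistW h ^ 2 * Real.sin h + Real.cos (twistTheta h) * Real.cos h) *
              twistW h ^ 2 -
            Real.cos (twistTheta h) * Real.sin h * (2 * twistW h * -Real.sin h)) /
          (twistW h ^ 2) ^ 2) h :=
    hA.neg.add (hB.div (hasDerivAt_twistW_sq h) (pow_ne_zero 2 hW))
  refine H.congr_deriv ?_
  unfold twistSlope twistP
  field_simp
  ring

/-- `Q₁' = m Q`. [folklore] -/
theorem hasDerivAt_twistQ₁ (h : ℝ) : HasDerivAt twistQ₁ (twistSlope h * twistQ h) h := by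
  have hW := twistW_ne_zero h
  have hA : HasDerivAt (fun y => twistW y * Real.cos (twistTheta y))
      (-Real.sin h * Real.cos (twistTheta h) + twistW h * (-Real.sin (twistTheta h) * twistW h ^ 2)) h :=
    (hasDerivAt_twistW h).mul (hasDerivAt_cos_twistTheta h)
  have hB : HasDerivAt (fun y => Real.sin (twistTheta y) * Real.sin y)
      (Real.cos (twistTheta h) * twistW h ^ 2 * Real.sin h + Real.sin (twistTheta h) * Real.cos h) h :=
    (hasDerivAt_sin_twistTheta h).mul (Real.hasDerivAt_sin h)
  have H : HasDerivAt twistQ₁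
      (-Real.sin h * Real.cos (twistTheta h) + twistW h * (-Real.sin (twistTheta h) * twistW h ^ 2) +
        ((Real.cos (twistTheta h) * twistW h ^ 2 * Real.sin h + Real.sin (twistTheta h) * Real.cos h) *
              twistW h ^ 2 -
            Real.sin (twistTheta h) * Real.sin h * (2 * twistW h * -Real.sin h)) /
          (twistW h ^ 2) ^ 2) h :=
    hA.add (hB.div (hasDerivAt_twistW_sq h) (pow_ne_zero 2 hW))
  refine H.congr_deriv ?_
  unfold twistSlope twistQ
  field_simp
  ring

/-- `m' = twistSlopeD`. [folklore] -/
theorem hasDerivAt_twistSlope (h : ℝ) : HasDerivAt twistSlope (twistSlopeD h) h := by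
  have hW := twistW_ne_zero h
  have hN : HasDerivAt (fun y => twistW y * Real.cos y + 2 * Real.sin y ^ 2)
      (-Real.sin h * Real.cos h + twistW h * -Real.sin h + 2 * (2 * Real.sin h * Real.cos h)) h :=
    ((hasDerivAt_twistW h).mul (Real.hasDerivAt_cos h)).add ((hasDerivAt_sin_sq h).const_mul 2)
  have H : HasDerivAt twistSlope
      (((-Real.sin h * Real.cos h + twistW h * -Real.sin h + 2 * (2 * Real.sin h * Real.cos h)) * twistW h ^ 2 -
            (twistW h * Real.cos h + 2 * Real.sin h ^ 2) * (2 * twistW h * -Real.sin h)) /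
          (twistW h ^ 2) ^ 2 -
        4 * twistW h ^ 3 * -Real.sin h) h :=
    (hN.div (hasDerivAt_twistW_sq h) (pow_ne_zero 2 hW)).sub (hasDerivAt_twistW_pow_four h)
  refine H.congr_deriv ?_
  unfold twistSlopeD
  field_simp
  ring

/-- The Wronskian `P₁ Q − Q₁ P = −1`. [folklore] -/
theorem twistWronskian (h : ℝ) : twistP₁ h * twistQ h - twistQ₁ h * twistP h = -1 := by
  have hW := twistW_ne_zero h
  have key : twistP₁ h * twistQ h - twistQ₁ h * twistP h =
      -(Real.sin (twistTheta h) ^ 2 + Real.cos (twistTheta h) ^ 2) := by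
    unfold twistP₁ twistQ₁ twistP twistQ
    field_simp
    ring
  rw [key, Real.sin_sq_add_cos_sq]

/-- The slope as a function of `W` alone: `m = −1 + 6/W − 6/W² − W⁴`. [folklore] -/
theorem twistSlope_eq (h : ℝ) : twistSlope h = -1 + 6 / twistW h - 6 / twistW h ^ 2 - twistW h ^ 4 := by
  have hW := twistW_ne_zero h
  have hc : Real.cos h = twistW h - 2 := by unfold twistW; ring
  have hs : Real.sin h ^ 2 = 1 - (twistW h - 2) ^ 2 := by rw [Real.sin_sq, hc]
  unfold twistSlope
  rw [hs, hc]
  field_simp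
  ring

/-- The slope is negative everywhere (`6/W − 6/W² ≤ 3/2`, `W⁴ ≥ 1`). [folklore] -/
theorem twistSlope_neg (h : ℝ) : twistSlope h < 0 := by
  have hW1 := one_le_twistW h
  have hWpos := twistW_pos h
  rw [twistSlope_eq]
  have h1 : 6 / twistW h - 6 / twistW h ^ 2 ≤ 3 / 2 := by
    rw [div_sub_div _ _ (twistW_ne_zero h) (pow_ne_zero 2 (twistW_ne_zero h)), div_le_div_iff₀ (by positivity)
      (by norm_num)]
    nlinarith [sq_nonneg (twistW h - 2), mul_pos hWpos hWpos]
  have h4 : 1 ≤ twistW h ^ 4 := one_le_pow₀ hW1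
  linarith

/-- `m ≠ 1`. [folklore] -/
theorem twistSlope_sub_one_ne_zero (h : ℝ) : twistSlope h - 1 ≠ 0 := by
  have := twistSlope_neg h; intro h'; linarith

/-! ## The twisted column field, its vorticity pattern, the profile and the window (definitions; the calculus is in
`…Negative.TwistedColumnField` and `…Negative.TwistedColumn`) -/

/-- The twisted column `V(x) = (−P₁(x₂) sin x₀, −Q₁(x₂) sin x₁, P(x₂) cos x₀ + Q(x₂) cos x₁)`. [folklore] -/
def twistField (x : E3) : E3 :=
  (-(twistP₁ (x 2) * Real.sin (x 0))) • (𝐞 0) + (-(twistQ₁ (x 2) * Real.sin (x 1))) • (𝐞 1) +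
    (twistP (x 2) * Real.cos (x 0) + twistQ (x 2) * Real.cos (x 1)) • (𝐞 2)

/-- The derivative `DV(x)` of the twisted column, as an explicit continuous linear map. [folklore] -/
def twistDeriv (x : E3) : E3 →L[ℝ] E3 :=
  (-(twistP₁ (x 2) • (Real.cos (x 0) • (π 0)) +
      Real.sin (x 0) • ((twistSlope (x 2) * twistP (x 2)) • (π 2)))).smulRight (𝐞 0) +
  (-(twistQ₁ (x 2) • (Real.cos (x 1) • (π 1)) +
      Real.sin (x 1) • ((twistSlope (x 2) * twistQ (x 2)) • (π 2)))).smulRight (𝐞 1) +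
  ((twistP (x 2) • (-(Real.sin (x 0)) • (π 0)) + Real.cos (x 0) • (twistP₁ (x 2) • (π 2))) +
      (twistQ (x 2) • (-(Real.sin (x 1)) • (π 1)) + Real.cos (x 1) • (twistQ₁ (x 2) • (π 2)))).smulRight (𝐞 2)

/-- The vorticity pattern `K(x) = (m(x₂) − 1)(Q(x₂) sin x₁, −P(x₂) sin x₀, 0)` (`curl V = K`). [folklore] -/
def twistVort (x : E3) : E3 :=
  ((twistSlope (x 2) - 1) * twistQ (x 2) * Real.sin (x 1)) • (𝐞 0) +
    (-((twistSlope (x 2) - 1) * twistP (x 2) * Real.sin (x 0))) • (𝐞 1)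

/-- The derivative `DK(x)` of the vorticity pattern, as an explicit continuous linear map. [folklore] -/
def twistVortDeriv (x : E3) : E3 →L[ℝ] E3 :=
  (((twistSlope (x 2) - 1) * twistQ (x 2)) • (Real.cos (x 1) • (π 1)) +
      Real.sin (x 1) • (((twistSlope (x 2) - 1) * twistQ₁ (x 2) + twistSlopeD (x 2) * twistQ (x 2)) • (π 2))).smulRight
      (𝐞 0) +
  (-(((twistSlope (x 2) - 1) * twistP (x 2)) • (Real.cos (x 0) • (π 0)) +
      Real.sin (x 0) • (((twistSlope (x 2) - 1) * twistP₁ (x 2) + twistSlopeD (x 2) * twistP (x 2)) • (π 2)))).smulRight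
      (𝐞 1)

/-- The twisted column profile `v(t, x) = (−t)^{-1/2} V(x)` (`cellAmp t = (−t)^{-1/2}` of `…Negative.CellField`).
[folklore] -/
def twistProfile (t : ℝ) (x : E3) : E3 := cellAmp t • twistField x

/-- The derivative of `x ↦ ∂₂v₂(t, x) = (−t)^{-1/2}(P₁(x₂) cos x₀ + Q₁(x₂) cos x₁)`, as an explicit continuous linear map.
[folklore] -/
def twistDzVzDeriv (t : ℝ) (x : E3) : E3 →L[ℝ] ℝ :=
  cellAmp t • ((twistP₁ (x 2) • (-(Real.sin (x 0)) • (π 0)) + Real.cos (x 0) • ((twistSlope (x 2) * twistP (x 2)) • (π 2))) +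
    (twistQ₁ (x 2) • (-(Real.sin (x 1)) • (π 1)) + Real.cos (x 1) • ((twistSlope (x 2) * twistQ (x 2)) • (π 2))))

/-- The space–time window `{t < 0} × {x | 0 < x₀ < π, 0 < x₁ < π, 0 < x₂ < 3/20}` of the falsity theorems. [folklore] -/
def twistWindow : Set (ℝ × E3) :=
  Set.Iio (0 : ℝ) ×ˢ {x : E3 | 0 < x 0 ∧ x 0 < Real.pi ∧ 0 < x 1 ∧ x 1 < Real.pi ∧ 0 < x 2 ∧ x 2 < 3 / 20}

end Summit.NavierStokesRegularity.NavierStokesRegularity.Theorems.LrcModEntire.Negative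

end
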